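import Summits.NavierStokesRegularity.FunctionalMining.StretchingLaminateDagSound
import HarnessLib

/-!
# K1-Q1 laminates: BANDED DAG certificates — the state-indexed dynamic programme split across several
declarations through small CLAIMED boundary tables, with the gluing theorems

NS FUNCTIONAL MINING cell (`pub-nsfunc`), prove seat gen 15, 2026-08-21 — **search for candidate a
priori estimates; no regularity claim.** STATIC bookkeeping only: nothing about Navier–Stokes solutions
is asserted anywhere in this file.

WHY. One `decide +kernel` evaluation of `Dag.checkChunks` is bounded by the kernel's MEMORY (whnf cache +
big rationals): measured on the farm, the bank's K = 24 policy DAG (2 043 states, σ/E digit mass ≈ 0.63 M)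
passes, K = 28 (2 371 states, ≈ 0.89 M) and K = 32 (2 937 states, 370-digit σ, ≈ 1.39 M) raise
"(kernel) excessive memory consumption detected". The bank's hub/excursion DAGs have a 6-state WAIST at
every height, so the programme can be cut into BANDS evaluated in SEPARATE declarations: a band starts
from a store PRE-LOADED with a claimed table of (index, state, σ, E, M²) for the ≤ 6 states below the cut
that it references, runs its chunks, and VERIFIES that it reproduces the claimed table of the next cut
(last band: the root test). The claims are untrusted data: each is checked by the band that computes it.

WHAT IS HERE: `Dag.preload`, `Dag.outputsOk`, **`Dag.bandCheck inputs parts i0 outputs`**,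
**`Dag.bandCheckRoot inputs parts i0 root r`** (kernel-evaluable); `Dag.TableGood` (a claimed table is
truthful in the sense of `Dag.Good`); **`Dag.tableGood_of_bandCheck`** (truthful inputs + passing band ⇒
truthful outputs), **`Dag.cert_treeOf_of_bandCheckRoot`** (truthful inputs + passing root band ⇒
`(treeOf nodes root).cert r = true`), `Dag.tableGood_nil`, the index bookkeeping `Dag.agree_of_append`,
and the assemblies to `C_lam` / `C⋆`. Unit test: the board DAG in two bands (`board_banded_cert`). Records:
`…DagRecord*.lean`.
[ours; bookkeeping + checker soundness. No literature claim.]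
-/

namespace Summit.NavierStokesRegularity.FunctionalMining

namespace Laminate

namespace Dag

/-! ## 1. Claimed tables, band checkers (kernel-evaluated) -/

/-- Decidable equality of stored summaries (state + three rationals), field by field. [ours; bookkeeping] -/
instance Val.instDecidableEq : DecidableEq Val := fun a b =>
  if h : a.G = b.G ∧ a.sig = b.sig ∧ a.en = b.en ∧ a.vs = b.vs then
    isTrue (by
      obtain ⟨_, _, _, _⟩ := a
      obtain ⟨_, _, _, _⟩ := b
      simp only at h
      obtain ⟨h1, h2, h3, h4⟩ := h
      subst h1 h2 h3 h4
      rfl)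
  else isFalse (fun hab => h (by subst hab; exact ⟨rfl, rfl, rfl, rfl⟩))

/-- Pre-load a store with a claimed table (head entry wins on duplicate indices). [ours; bookkeeping] -/
def preload : List (ℕ × Val) → Store
  | [] => Store.nil
  | (j, v) :: rest => (preload rest).set (j + 1) j v

/-- Every claimed output `(j, v)` has `j < bound` and is reproduced EXACTLY by the store. [ours; bookkeeping] -/
def outputsOk (st : Store) (bound : ℕ) : List (ℕ × Val) → Bool
  | [] => true
  | (j, v) :: rest =>
    decide (j < bound) && (match st.get j with | some w => decide (w = v) | none => false)
      && outputsOk st bound rest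

/-- **Band check**: pre-load `inputs`, run the chunks `parts` from node index `i0`, verify `outputs`.
[ours; bookkeeping] -/
def bandCheck (inputs : List (ℕ × Val)) (parts : List (List Node)) (i0 : ℕ)
    (outputs : List (ℕ × Val)) : Bool :=
  match runChunks parts i0 (preload inputs) with
  | none => false
  | some st => outputsOk st (i0 + parts.flatten.length) outputs

/-- **Root band check**: pre-load `inputs`, run the chunks from `i0`, then the root test (`rootOk`:
state `0`, signs, `r²E²M² ≤ σ²`) at node index `root`, which must lie in this band. [ours; bookkeeping] -/
def bandCheckRoot (inputs : List (ℕ × Val)) (parts : List (List Node)) (i0 root : ℕ) (r : ℚ) : Bool :=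
  match runChunks parts i0 (preload inputs) with
  | none => false
  | some st => decide (root < i0 + parts.flatten.length) &&
      (match st.get root with | some v => rootOk v r | none => false)

/-! ## 2. Soundness of the bands -/

/-- A claimed table is TRUTHFUL: every entry is `Good` (its statistics are those of the unfolded
sub-laminate of `nodes` at that index, from its own state, and that sub-laminate is valid). [ours; bookkeeping] -/
def TableGood (nodes : List Node) (T : List (ℕ × Val)) : Prop :=
  ∀ p ∈ T, Good nodes p.1 p.2

/-- The empty table is truthful. [ours; bookkeeping] -/
theorem tableGood_nil (nodes : List Node) : TableGood nodes [] := fun _ h => by simp at h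

/-- What a pre-loaded store contains. [ours; bookkeeping] -/
theorem mem_of_get_preload : ∀ (T : List (ℕ × Val)) (j : ℕ) (v : Val),
    (preload T).get j = some v → (j, v) ∈ T
  | [], j, v, h => by simp [preload, Store.get] at h
  | (j', v') :: rest, j, v, h => by
    simp only [preload, Store.get_set_succ] at h
    by_cases hj : j = j'
    · subst hj
      simp only [↓reduceIte, Option.some.injEq] at h
      subst h; simp
    · rw [if_neg hj] at h
      exact List.mem_cons_of_mem _ (mem_of_get_preload rest j v h)

/-- A truthful table pre-loads to a store satisfying the invariant (at every index bound). [ours; bookkeeping] -/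
theorem inv_preload {nodes : List Node} {T : List (ℕ × Val)} (hT : TableGood nodes T) (k : ℕ) :
    Inv nodes (preload T) k :=
  fun j _ v hv => hT (j, v) (mem_of_get_preload T j v hv)

/-- `outputsOk` read back. [ours; bookkeeping] -/
theorem of_outputsOk {st : Store} {bound : ℕ} : ∀ {outs : List (ℕ × Val)},
    outputsOk st bound outs = true → ∀ p ∈ outs, p.1 < bound ∧ st.get p.1 = some p.2
  | [], _, p, hp => by simp at hp
  | (j, v) :: rest, h, p, hp => by
    simp only [outputsOk, Bool.and_eq_true, decide_eq_true_eq] at h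
    obtain ⟨⟨hjb, hget⟩, hrest⟩ := h
    rcases List.mem_cons.mp hp with hp | hp
    · subst hp
      refine ⟨hjb, ?_⟩
      cases hg : st.get j with
      | none => rw [hg] at hget; simp at hget
      | some w =>
        rw [hg] at hget
        simp only [decide_eq_true_eq] at hget
        rw [hget]
    · exact of_outputsOk hrest p hp

/-- **Band soundness**: truthful inputs and a passing band make the claimed outputs truthful.
`hagree` says the band's data are the nodes of `nodes` from index `i0` on. [ours] -/
theorem tableGood_of_bandCheck {nodes : List Node} {inputs outputs : List (ℕ × Val)}
    {parts : List (List Node)} {i0 : ℕ} (hin : TableGood nodes inputs)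
    (hagree : ∀ k nd, parts.flatten[k]? = some nd → nodes[i0 + k]? = some nd)
    (h : bandCheck inputs parts i0 outputs = true) : TableGood nodes outputs := by
  unfold bandCheck at h
  cases hrun : runChunks parts i0 (preload inputs) with
  | none => rw [hrun] at h; simp at h
  | some st =>
    rw [hrun] at h
    simp only at h
    have hinv := inv_runChunks (nodes := nodes) parts i0 (preload inputs) st hagree
      (inv_preload hin i0) hrun
    intro p hp
    obtain ⟨hpb, hget⟩ := of_outputsOk h p hp
    exact hinv p.1 hpb p.2 hget

/-- **Root-band soundness**: truthful inputs and a passing root band certify the unfolded tree below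
`root`. [ours] -/
theorem cert_treeOf_of_bandCheckRoot {nodes : List Node} {inputs : List (ℕ × Val)}
    {parts : List (List Node)} {i0 root : ℕ} {r : ℚ} (hin : TableGood nodes inputs)
    (hagree : ∀ k nd, parts.flatten[k]? = some nd → nodes[i0 + k]? = some nd)
    (h : bandCheckRoot inputs parts i0 root r = true) : (treeOf nodes root).cert r = true := by
  unfold bandCheckRoot at h
  cases hrun : runChunks parts i0 (preload inputs) with
  | none => rw [hrun] at h; simp at h
  | some st =>
    rw [hrun] at h
    simp only [Bool.and_eq_true, decide_eq_true_eq] at h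
    obtain ⟨hroot, h⟩ := h
    have hinv := inv_runChunks (nodes := nodes) parts i0 (preload inputs) st hagree
      (inv_preload hin i0) hrun
    cases hget : st.get root with
    | none => rw [hget] at h; simp at h
    | some v =>
      rw [hget] at h
      simp only [rootOk, Bool.and_eq_true, decide_eq_true_eq] at h
      obtain ⟨⟨⟨⟨⟨hG, hr⟩, hσ⟩, hE⟩, hM⟩, hineq⟩ := h
      have hgood := hinv root hroot v hget
      simp only [Tree.cert, Tree.sigma, Tree.energy, Tree.vortSup, Bool.and_eq_true, decide_eq_true_eq]
      rw [← hG, ← hgood.sig_eq, ← hgood.en_eq, ← hgood.vs_eq]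
      exact ⟨⟨⟨⟨⟨hgood.valid, hr⟩, hσ⟩, hE⟩, hM⟩, hineq⟩

/-- Index bookkeeping for a band whose data `parts` sit between `pre` and `post` in the node list.
[ours; bookkeeping] -/
theorem agree_of_append (nodes pre post : List Node) (parts : List (List Node)) {i0 : ℕ}
    (hn : nodes = pre ++ parts.flatten ++ post) (hi0 : pre.length = i0) :
    ∀ k nd, parts.flatten[k]? = some nd → nodes[i0 + k]? = some nd := by
  intro k nd hk
  have hk' : k < parts.flatten.length := (List.getElem?_eq_some_iff.mp hk).1
  subst hn hi0
  rw [List.append_assoc, List.getElem?_append_right (by omega), Nat.add_sub_cancel_left,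
    List.getElem?_append_left hk']
  exact hk

/-- **Banded certificate ⇒ `r ≤ C_lam`.** [ours] -/
theorem le_laminateSupConst_of_cert_treeOf {nodes : List Node} {root : ℕ} {r : ℚ}
    (h : (treeOf nodes root).cert r = true) : ((r : ℚ) : ℝ) ≤ laminateSupConst :=
  le_laminateSupConst_of_cert _ r h

/-- **Banded certificate ⇒ `r ≤ C⋆`, UNCONDITIONALLY** (`laminateRealization_holds`). [ours] -/
theorem le_stretchingSupConst_of_cert_treeOf {nodes : List Node} {root : ℕ} {r : ℚ}
    (h : (treeOf nodes root).cert r = true) : ((r : ℚ) : ℝ) ≤ stretchingSupConst (d := Fin 3) :=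
  le_stretchingSupConst_of_cert laminateRealization_holds _ r h

/-! ## 3. Unit test: the board DAG in two bands -/

/-- Band 1 of the board: states 0–2 (no inputs); claimed outputs = the summaries of states 1 and 2,
which band 2 references. [ours; bookkeeping] -/
def boardBand1 : List (List Node) := [boardDag.take 3]

/-- Band 2 of the board: states 3–4. [ours; bookkeeping] -/
def boardBand2 : List (List Node) := [boardDag.drop 3]

/-- The claimed boundary table between the two board bands (states 1 and 2 with their statistics).
[ours; bookkeeping] -/
def boardTable : List (ℕ × Val) :=
  [(2, ⟨Grad.zero.layer (1 - 1/2) ⟨1/2, 1/2, (-1/2), 0, 1, 1, 0⟩, 1/4, 1/2, 1⟩),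
   (1, ⟨(Grad.zero.layer (-(1/2)) ⟨1/2, 1/2, (-1/2), 0, 1, 1, 0⟩).layer (1 - 1/2)
      ⟨1/2, (-1/2), (-1/2), 0, 1, (-1), 0⟩, 1/2, 3/4, 1⟩)]

/-- Band 1 passes and reproduces the table. [ours; computation] -/
theorem boardBand1_check : bandCheck [] boardBand1 0 boardTable = true := by
  decide +kernel

/-- Band 2 passes from the table and certifies the root (index 4) with `r = 1/2`. [ours; computation] -/
theorem boardBand2_check : bandCheckRoot boardTable boardBand2 3 4 (1 / 2) = true := by
  decide +kernel

/-- Gluing the two board bands: `(treeOf boardDag 4).cert (1/2)`. [ours] -/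
theorem board_banded_cert : (treeOf boardDag 4).cert (1 / 2) = true :=
  cert_treeOf_of_bandCheckRoot
    (tableGood_of_bandCheck (tableGood_nil boardDag)
      (agree_of_append boardDag [] (boardDag.drop 3) boardBand1 (by rfl) rfl) boardBand1_check)
    (agree_of_append boardDag (boardDag.take 3) [] boardBand2 (by rfl) rfl) boardBand2_check

end Dag

end Laminate

end Summit.NavierStokesRegularity.FunctionalMining
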